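import Summits.Ventures.YMGap.FlowData.RectTubeFluxNonAnnihilation
import Summits.Ventures.YMGap.FlowData.RectTubeVacuumSector
import Summits.Ventures.YMGap.FlowData.RectTubeTransferPositivity
import Literature.Analysis.OperatorTheory.CompactPositiveTopLevel
import HarnessLib

/-!
# Venture YMGap, track Y3 FLOW-DATA — RECTANGULAR tubes: the SECTOR TOP `λ̂₀^{(e)} = ‖T ∘ P_e‖` IS AN ATTAINED
# EIGENVALUE of the tube transfer operator, with an eigenvector IN the flux sector `e`, and the largest one there
# (theorems only; twin of `TubeSectorEigenvalue.lean` for `RectSlice Ls`)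

HONEST FRAMING: venture file of the cell `pub-ymgap` (QuantumFields programme), track Y3; the DICTIONARY theorem of
`TubeSectorEigenvalue.lean` for the rectangular cross-sections `×_i ℤ/(Ls i)` of `RectTubeTransferOperator.lean` (the
table's `2×3`, `2×4` cells, `E1` / `E1_axis1`).  FLOW-PLAN O1 defines `λ̂₀^{(e)} := max spec T̂ restricted to flux e`;
the tree types the flux energies through the OPERATOR NORM `rectTubeSectorNorm = ‖T ∘ P_e‖`.  Here: for a continuous
unitary representation `ρ`, a central involution `z` and `J ≥ 0`, whenever `‖T ∘ P_e‖ > 0` there is a UNIT VECTOR `φ`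
with `P_e φ = φ` and `T φ = ‖T ∘ P_e‖ · φ`, and every eigenvalue of `T` carried by the sector `e` lies in `[0, ‖T ∘ P_e‖]`
(`T ∘ P_e` compact, self-adjoint, Lüscher-positive ⇒ Hilbert–Schmidt theorem, tree
`CompactPositiveTopLevel.exists_eigenvector_norm_of_re_inner_nonneg`).  Finite spatial torus, one transfer step; nothing
about `L → ∞`, the continuum or a mass gap; no number, no row.

* `isCompactOperator_comp_rectTubeFluxProjection`, `isSelfAdjoint_comp_rectTubeFluxProjection`,
  `inner_comp_rectTubeFluxProjection_self_nonneg` — `T ∘ P_e` is compact, self-adjoint, positive;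
* ★ `exists_eigenvector_rectTubeSectorNorm` — `0 < ‖T ∘ P_e‖ → ∃ φ, ‖φ‖ = 1 ∧ P_e φ = φ ∧ T φ = ‖T ∘ P_e‖ • φ`;
* `rect_eigenvalue_mem_Icc_of_mem_sector` — `P_e ψ = ψ → ψ ≠ 0 → T ψ = μ • ψ → μ ∈ [0, ‖T ∘ P_e‖]`;
* ★ `su2_exists_eigenvector_rectSectorTop` — the cell's case (`SU(2)`, fundamental, `z = −1`, `J = β/2`), EVERY `β > 0`,
  EVERY side vector `Ls` and axis `μ`: `su2RectSectorTop β Ls μ` is an eigenvalue of `T̂` attained on the sector `ê_μ`;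
  `su2RectTorelonEnergy_eq_log_div` — `E_μ = log λ̂₀ − log λ̂₀^{(ê_μ)}` with BOTH `λ̂`'s genuine eigenvalues.

References: M. Lüscher, Commun. Math. Phys. 54 (1977) 283 [cite: Luscher1977]; G. 't Hooft, Nucl. Phys. B 153 (1979)
141 [cite: tHooft1979Flux]; M. Reed, B. Simon I (1980) Thm VI.16 [cite: ReedSimonI1980, Thm. VI.16]; IV (1978) XIII.12
[cite: ReedSimonIV1978, Thm XIII.44].
-/

noncomputable section

open scoped InnerProductSpace
open MeasureTheory
open Literature.MathematicalPhysics.QuantumFieldTheory Literature.Analysis.OperatorTheory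
open Literature.MathematicalPhysics.QuantumLattice (RectTorusSite fundamentalRep continuous_fundamentalRep
  fundamentalRep_mem_unitaryGroup)

namespace Summit.Ventures.YMGap.FlowData

section General

variable {G : Type*} [Group G] [TopologicalSpace G] [IsTopologicalGroup G] [CompactSpace G]
  [MeasurableSpace G] [BorelSpace G] [SecondCountableTopology G]
  {n k : ℕ} (ρ : G →* Matrix (Fin n) (Fin n) ℂ) (J : ℝ) {Ls : Fin k → ℕ} [∀ i, NeZero (Ls i)]

/-- `T ∘ P_e` is a compact operator (`T` is). [folklore] -/
theorem isCompactOperator_comp_rectTubeFluxProjection (hρ : Continuous ρ) (z : G) (e : Fin k → ZMod 2) :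
    IsCompactOperator ((rectTubeTransferOperator ρ J Ls).comp (rectTubeFluxProjection z Ls e)) :=
  (isCompactOperator_rectTubeTransferOperator J Ls hρ).comp_clm (rectTubeFluxProjection z Ls e)

/-- `T ∘ P_e` is self-adjoint (central involution `z`, unitary `ρ`). [cite: tHooft1979Flux] -/
theorem isSelfAdjoint_comp_rectTubeFluxProjection (hρ : Continuous ρ)
    (hρu : ∀ g, ρ g ∈ Matrix.unitaryGroup (Fin n) ℂ) {z : G} (hz : z ∈ Subgroup.center G) (hz2 : z * z = 1)
    (e : Fin k → ZMod 2) :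
    IsSelfAdjoint ((rectTubeTransferOperator ρ J Ls).comp (rectTubeFluxProjection z Ls e)) := by
  have hT := isSelfAdjoint_rectTubeTransferOperator J Ls hρ hρu
  have hP := isSelfAdjoint_rectTubeFluxProjection z hz2 (Ls := Ls) e
  have hcomm : Commute (rectTubeTransferOperator ρ J Ls) (rectTubeFluxProjection z Ls e) := by
    change rectTubeTransferOperator ρ J Ls * rectTubeFluxProjection z Ls e =
      rectTubeFluxProjection z Ls e * rectTubeTransferOperator ρ J Ls
    rw [ContinuousLinearMap.mul_def, ContinuousLinearMap.mul_def]
    exact (rectTubeFluxProjection_comp_rectTubeTransferOperator ρ J hρ hz e).symm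
  exact (IsSelfAdjoint.commute_iff hT hP).1 hcomm

/-- `T ∘ P_e ⪰ 0` in quadratic form for `J ≥ 0`. [cite: Luscher1977] -/
theorem inner_comp_rectTubeFluxProjection_self_nonneg (hρ : Continuous ρ)
    (hρu : ∀ g, ρ g ∈ Matrix.unitaryGroup (Fin n) ℂ) {z : G} (hz : z ∈ Subgroup.center G) (hz2 : z * z = 1)
    (hJ : 0 ≤ J) (e : Fin k → ZMod 2) (x : Lp ℝ 2 (rectSliceMeasure G Ls)) :
    0 ≤ @inner ℝ _ _ x (((rectTubeTransferOperator ρ J Ls).comp (rectTubeFluxProjection z Ls e)) x) := by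
  set T := rectTubeTransferOperator ρ J Ls
  set P := rectTubeFluxProjection z Ls e
  have hPP : P.comp P = P := rectTubeFluxProjection_comp_self z hz2 e
  have hPT : P.comp T = T.comp P := rectTubeFluxProjection_comp_rectTubeTransferOperator ρ J hρ hz e
  have hPsa : IsSelfAdjoint P := isSelfAdjoint_rectTubeFluxProjection z hz2 (Ls := Ls) e
  have h1 : (T.comp P) x = P (T (P x)) := by
    have := congrArg (fun S : Lp ℝ 2 (rectSliceMeasure G Ls) →L[ℝ] Lp ℝ 2 (rectSliceMeasure G Ls) => S x)
      (show T.comp P = (P.comp T).comp P by rw [hPT, ContinuousLinearMap.comp_assoc, hPP])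
    simpa using this
  rw [h1, ← ContinuousLinearMap.adjoint_inner_left, hPsa.adjoint_eq]
  exact inner_rectTubeTransferOperator_self_nonneg ρ hρ hρu hJ (P x)

/-- ★ **The sector top is an attained eigenvalue (rectangular tube).**  For continuous unitary `ρ`, central involution
`z`, `J ≥ 0` and a flux `e` with `‖T ∘ P_e‖ > 0`: there is a unit `φ` IN the sector with `T φ = ‖T ∘ P_e‖ · φ`.
[cite: ReedSimonI1980, Thm. VI.16] -/
theorem exists_eigenvector_rectTubeSectorNorm (hρ : Continuous ρ) (hρu : ∀ g, ρ g ∈ Matrix.unitaryGroup (Fin n) ℂ)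
    {z : G} (hz : z ∈ Subgroup.center G) (hz2 : z * z = 1) (hJ : 0 ≤ J) {e : Fin k → ZMod 2}
    (hpos : 0 < rectTubeSectorNorm ρ z J Ls e) :
    ∃ φ : Lp ℝ 2 (rectSliceMeasure G Ls), ‖φ‖ = 1 ∧ rectTubeFluxProjection z Ls e φ = φ ∧
      rectTubeTransferOperator ρ J Ls φ = rectTubeSectorNorm ρ z J Ls e • φ := by
  set T := rectTubeTransferOperator ρ J Ls
  set P := rectTubeFluxProjection z Ls e
  have hS : rectTubeSectorNorm ρ z J Ls e = ‖T.comp P‖ := rfl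
  have hne : T.comp P ≠ 0 := by
    intro h; rw [hS, h, norm_zero] at hpos; exact lt_irrefl _ hpos
  obtain ⟨x, hx⟩ := DFunLike.ne_iff.1 hne
  haveI : Nontrivial (Lp ℝ 2 (rectSliceMeasure G Ls)) := nontrivial_of_ne _ _ hx
  obtain ⟨φ, hφ1, hφ⟩ := exists_eigenvector_norm_of_re_inner_nonneg (𝕜 := ℝ)
    (isSelfAdjoint_comp_rectTubeFluxProjection ρ J hρ hρu hz hz2 e)
    (isCompactOperator_comp_rectTubeFluxProjection ρ J hρ z e)
    (fun (x : Lp ℝ 2 (rectSliceMeasure G Ls)) => by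
      simpa using inner_comp_rectTubeFluxProjection_self_nonneg ρ J hρ hρu hz hz2 hJ e x)
  have hφ' : T (P φ) = ‖T.comp P‖ • φ := by simpa using hφ
  have hPP : P.comp P = P := rectTubeFluxProjection_comp_self z hz2 e
  have hPT : P.comp T = T.comp P := rectTubeFluxProjection_comp_rectTubeTransferOperator ρ J hρ hz e
  have hnorm : ‖T.comp P‖ ≠ 0 := by rw [← hS]; exact hpos.ne'
  have hPφ : P φ = φ := by
    have h1 : P (T (P φ)) = T (P φ) := by
      have := congrArg (fun S : Lp ℝ 2 (rectSliceMeasure G Ls) →L[ℝ] Lp ℝ 2 (rectSliceMeasure G Ls) => S φ)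
        (show (P.comp T).comp P = T.comp P by rw [hPT, ContinuousLinearMap.comp_assoc, hPP])
      simpa using this
    rw [hφ', map_smul] at h1
    have h2 := congrArg (fun v => ‖T.comp P‖⁻¹ • v) h1
    simp only [smul_smul, inv_mul_cancel₀ hnorm, one_smul] at h2
    exact h2
  refine ⟨φ, hφ1, hPφ, ?_⟩
  rw [hS, ← hφ', hPφ]

/-- **Maximality (rectangular tube)**: every eigenvalue of `T` carried by a vector of the sector `e` lies in
`[0, ‖T ∘ P_e‖]` (`J ≥ 0`). [cite: ReedSimonIV1978, Thm XIII.44] -/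
theorem rect_eigenvalue_mem_Icc_of_mem_sector (hρ : Continuous ρ) (hρu : ∀ g, ρ g ∈ Matrix.unitaryGroup (Fin n) ℂ)
    (hJ : 0 ≤ J) (z : G) {e : Fin k → ZMod 2} {ψ : Lp ℝ 2 (rectSliceMeasure G Ls)} {μ : ℝ}
    (hψP : rectTubeFluxProjection z Ls e ψ = ψ) (hψ : ψ ≠ 0) (heig : rectTubeTransferOperator ρ J Ls ψ = μ • ψ) :
    μ ∈ Set.Icc 0 (rectTubeSectorNorm ρ z J Ls e) := by
  set T := rectTubeTransferOperator ρ J Ls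
  set P := rectTubeFluxProjection z Ls e
  have hψn : 0 < ‖ψ‖ := norm_pos_iff.2 hψ
  constructor
  · have h := inner_rectTubeTransferOperator_self_nonneg ρ hρ hρu hJ ψ
    rw [heig, inner_smul_right, real_inner_self_eq_norm_sq] at h
    nlinarith [h, pow_pos hψn 2]
  · have h1 : (T.comp P) ψ = μ • ψ := by simp [P, hψP, heig, T]
    have h2 : ‖(T.comp P) ψ‖ ≤ ‖T.comp P‖ * ‖ψ‖ := (T.comp P).le_opNorm ψ
    rw [h1, norm_smul, Real.norm_eq_abs] at h2
    have h3 : |μ| ≤ ‖T.comp P‖ := le_of_mul_le_mul_right h2 hψn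
    exact (le_abs_self μ).trans h3

end General

/-! ### The cell's case: `SU(2)`, fundamental representation, `z = −1`, `J = β/2` -/

section SU2

variable {k : ℕ}

/-- ★ **Every axis sector top of the SU(2) rectangular tube is an attained eigenvalue**: for every `β > 0`, side vector
`Ls` and axis `μ` there is a unit `φ` in the sector `ê_μ` with `T̂ φ = λ̂₀^{(ê_μ)} φ`, `λ̂₀^{(ê_μ)} = su2RectSectorTop β Ls μ`.
[cite: ReedSimonI1980, Thm. VI.16] -/
theorem su2_exists_eigenvector_rectSectorTop {β : ℝ} (hβ : 0 < β) (Ls : Fin k → ℕ) [∀ i, NeZero (Ls i)]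
    (μ : Fin k) :
    ∃ φ : Lp ℝ 2 (rectSliceMeasure (Matrix.specialUnitaryGroup (Fin 2) ℂ) Ls), ‖φ‖ = 1 ∧
      rectTubeFluxProjection su2MinusOne Ls (Pi.single μ 1) φ = φ ∧
      rectTubeTransferOperator (fundamentalRep (Fin 2)) (β / 2) Ls φ = su2RectSectorTop β Ls μ • φ := by
  haveI : SecondCountableTopology (Matrix.specialUnitaryGroup (Fin 2) ℂ) :=
    Literature.MathematicalPhysics.QuantumLattice.secondCountableTopology_su2
  exact exists_eigenvector_rectTubeSectorNorm (fundamentalRep (Fin 2)) (β / 2) (continuous_fundamentalRep (Fin 2))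
    fundamentalRep_mem_unitaryGroup su2MinusOne_mem_center su2MinusOne_mul_self (by linarith)
    (su2_rectTubeSectorNorm_single_pos hβ.ne' Ls μ)

/-- The vacuum sector too: a unit `φ₀` in the sector `0` with `T̂ φ₀ = ‖T̂‖ φ₀` (every `β ≥ 0`).
[cite: ReedSimonIV1978, Thm XIII.44] -/
theorem su2_exists_eigenvector_rectSectorTop_zero {β : ℝ} (hβ : 0 ≤ β) (Ls : Fin k → ℕ) [∀ i, NeZero (Ls i)] :
    ∃ φ : Lp ℝ 2 (rectSliceMeasure (Matrix.specialUnitaryGroup (Fin 2) ℂ) Ls), ‖φ‖ = 1 ∧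
      rectTubeFluxProjection su2MinusOne Ls 0 φ = φ ∧
      rectTubeTransferOperator (fundamentalRep (Fin 2)) (β / 2) Ls φ =
        ‖rectTubeTransferOperator (fundamentalRep (Fin 2)) (β / 2) Ls‖ • φ := by
  haveI : SecondCountableTopology (Matrix.specialUnitaryGroup (Fin 2) ℂ) :=
    Literature.MathematicalPhysics.QuantumLattice.secondCountableTopology_su2
  have h0 := rectTubeSectorNorm_zero (fundamentalRep (Fin 2)) (β / 2) (continuous_fundamentalRep (Fin 2))
    fundamentalRep_mem_unitaryGroup su2MinusOne_mem_center (Ls := Ls)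
  have hpos : 0 < rectTubeSectorNorm (fundamentalRep (Fin 2)) su2MinusOne (β / 2) Ls 0 := by
    rw [h0]; exact norm_rectTubeTransferOperator_pos (β / 2) Ls (continuous_fundamentalRep (Fin 2))
  rw [← h0]
  exact exists_eigenvector_rectTubeSectorNorm (fundamentalRep (Fin 2)) (β / 2) (continuous_fundamentalRep (Fin 2))
    fundamentalRep_mem_unitaryGroup su2MinusOne_mem_center su2MinusOne_mul_self (by linarith) hpos

/-- **The two `λ̂`'s of `E_μ` are genuine eigenvalues**: for `β > 0` there are unit vectors `φ₀` (vacuum sector) and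
`φ_μ` (sector `ê_μ`) with `T̂ φ₀ = λ̂₀ φ₀`, `T̂ φ_μ = λ̂₀^{(ê_μ)} φ_μ`, `0 < λ̂₀^{(ê_μ)} ≤ λ̂₀`, and
`su2RectTorelonEnergy β Ls μ = log λ̂₀ − log λ̂₀^{(ê_μ)}`. [cite: tHooft1979Flux] -/
theorem su2RectTorelonEnergy_eq_log_div {β : ℝ} (hβ : 0 < β) (Ls : Fin k → ℕ) [∀ i, NeZero (Ls i)] (μ : Fin k) :
    ∃ (lam0 lamE : ℝ) (φ₀ φE : Lp ℝ 2 (rectSliceMeasure (Matrix.specialUnitaryGroup (Fin 2) ℂ) Ls)),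
      0 < lamE ∧ lamE ≤ lam0 ∧ ‖φ₀‖ = 1 ∧ ‖φE‖ = 1 ∧
      rectTubeTransferOperator (fundamentalRep (Fin 2)) (β / 2) Ls φ₀ = lam0 • φ₀ ∧
      rectTubeFluxProjection su2MinusOne Ls (Pi.single μ 1) φE = φE ∧
      rectTubeTransferOperator (fundamentalRep (Fin 2)) (β / 2) Ls φE = lamE • φE ∧
      su2RectTorelonEnergy β Ls μ = Real.log lam0 - Real.log lamE := by
  obtain ⟨φE, hE1, hEP, hEeig⟩ := su2_exists_eigenvector_rectSectorTop hβ Ls μ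
  obtain ⟨φ₀, h01, -, h0eig⟩ := su2_exists_eigenvector_rectSectorTop_zero hβ.le Ls
  exact ⟨‖rectTubeTransferOperator (fundamentalRep (Fin 2)) (β / 2) Ls‖, su2RectSectorTop β Ls μ, φ₀, φE,
    su2_rectTubeSectorNorm_single_pos hβ.ne' Ls μ, rectTubeSectorNorm_le_norm _ _ _ _ _, h01, hE1, h0eig, hEP,
    hEeig, rfl⟩

end SU2

end Summit.Ventures.YMGap.FlowData
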